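import Literature.NumberTheory.EllipticCurves.SharpFlatPAdicLFunctionCoeffField
import Literature.NumberTheory.EllipticCurves.PlusMinusPAdicLFunction
import Literature.NumberTheory.EllipticCurves.PAdicLFunctionInterpolationProofs
import Mathlib.NumberTheory.Padics.Complex
import HarnessLib

/-!
# Crux `ResidualThetaMainConjectureAtTwo` (stmt-BirchSwinnertonDyer-20787), line `birth` v7 — toward stub (R1d)
# `stub_pollackNonvanishingKAtTwo`: EVALUATING the `𝓞`-congruences and the Mazur–Tate elements of the partner at the
# wild characters (Pollack 2003, proofs of Prop. 6.9 / 6.18, for `θ_n(g; Ω) ∈ K_g[T]` read in `ℚ̄_p ⊂ ℂ_p`)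

Cell `bsd-wall`, seat `bsd-wall-rtt-p2` (LEAD PROVER, line mode, g2). THEOREMS ONLY (no `def`, no named fact, no
`sorry`); `--supports stmt-BirchSwinnertonDyer-20787`; closes nothing by itself.

* `IsCongrModOmegaO.eval₂_eq_mul` — a congruence `θ ≡ P·L (mod ω_n)` in `𝓞⟦T⟧ ⊗ ℚ` (`IsCongrModOmegaO`, `P ∈ ℚ̄_p[X]`,
  `L ∈ 𝓞⟦T⟧`) is an equality of values `θ(z) = P(z)·L(z)` in `ℂ_p` at every `z` with `|z| < 1`, `(1+z)^{pⁿ} = 1`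
  (the `𝓞`-coefficient twin of the tree's `IsCongrModOmega.eval₂_eq`; evaluation of bounded power series on the open
  unit disc, file `PAdicPowerSeriesZeros`).
* `eval₂_map_mazurTateElementK_eq_sum` — `θ_n(g; Ω)^ι(χ(γ) − 1) = Σ_{a mod p^{n+e₀}} χ(a)·ι[a/p^{n+e₀}]⁺_{g,Ω}` for an even
  `ℂ_p`-valued Dirichlet character `χ` mod `p^{n+e₀}` of `p`-power order (twin of
  `eval₂_mazurTateElement_eq_ratTwistedSymbolSum` for `K_g`-valued symbols).
BSD is not proved by any of this.

Refs: [Pollack2003] Prop. 6.9, Prop. 6.18 (proofs); [MazurTateTeitelbaum1986Invent] §I.13.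
-/

set_option linter.dupNamespace false
set_option autoImplicit false

noncomputable section

open scoped Classical

open Polynomial Literature.NumberTheory.EllipticCurves Literature.NumberTheory.EllipticCurves.ModularForms

namespace Summit.BirchSwinnertonDyer.BirchSwinnertonDyer.Theorems.ResidualThetaLayer

section Eval

variable {p : ℕ} [Fact p.Prime]

/-- **A congruence mod `ω_n` in `𝓞⟦T⟧ ⊗ ℚ` is an equality of values at the `ζ − 1`, `ζ ∈ μ_{pⁿ}`**: if
`p^m(θ − P·L) = ω_n·q` with `L, q ∈ 𝓞⟦T⟧` (`IsCongrModOmegaO S n θ (P·L)`) then `θ(z) = P(z)·L(z)` in `ℂ_p` for every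
`z` with `|z| < 1` and `(1 + z)^{pⁿ} = 1`. [cite: Pollack2003, Prop. 6.18 (proof)] -/
theorem IsCongrModOmegaO.eval₂_eq_mul {S : Set (PadicAlgCl p)} {n : ℕ} {θ P : (PadicAlgCl p)[X]}
    {L : IwasawaAlgebraO S}
    (h : IsCongrModOmegaO S n θ ((P : PowerSeries (PadicAlgCl p)) * iwasawaOToPowerSeries S L))
    {z : ℂ_[p]} (hz : ‖z‖ < 1) (hzn : (1 + z) ^ p ^ n = 1) :
    θ.eval₂ (algebraMap (PadicAlgCl p) ℂ_[p]) z =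
      P.eval₂ (algebraMap (PadicAlgCl p) ℂ_[p]) z *
        ∑' k, algebraMap (PadicAlgCl p) ℂ_[p] (PowerSeries.coeff k (iwasawaOToPowerSeries S L)) * z ^ k := by
  classical
  obtain ⟨m, q, hmq⟩ := h
  set φ : PadicAlgCl p →+* ℂ_[p] := algebraMap (PadicAlgCl p) ℂ_[p] with hφ
  have hφn : ∀ x, ‖φ x‖ = ‖x‖ := fun x ↦ PadicComplex.norm_extends p x
  -- coefficient bounds
  have hbdO : ∀ (A : IwasawaAlgebraO S) (k : ℕ), ‖φ (PowerSeries.coeff k (iwasawaOToPowerSeries S A))‖ ≤ 1 :=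
    fun A k ↦ by rw [hφn]; exact norm_coeff_iwasawaOToPowerSeries_le_one S A k
  have hbdP : ∀ (Q : (PadicAlgCl p)[X]) (k : ℕ), ‖φ (PowerSeries.coeff k (Q : PowerSeries (PadicAlgCl p)))‖ ≤
      Q.supNorm := fun Q k ↦ by rw [hφn, Polynomial.coeff_coe]; exact Q.le_supNorm k
  -- evaluation of `Q · ι A` for a polynomial `Q` and `A ∈ 𝓞⟦T⟧`
  have hevalmul : ∀ (Q : (PadicAlgCl p)[X]) (A : IwasawaAlgebraO S),
      HasSum (fun k ↦ φ (PowerSeries.coeff k ((Q : PowerSeries (PadicAlgCl p)) * iwasawaOToPowerSeries S A)) *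
          z ^ k)
        (Q.eval₂ φ z * ∑' k, φ (PowerSeries.coeff k (iwasawaOToPowerSeries S A)) * z ^ k) := by
    intro Q A
    have hs : Summable fun k ↦ φ (PowerSeries.coeff k
        ((Q : PowerSeries (PadicAlgCl p)) * iwasawaOToPowerSeries S A)) * z ^ k := by
      refine summable_map_coeff_mul_pow φ (C := Q.supNorm * 1) (fun k ↦ ?_) hz
      rw [PowerSeries.coeff_mul, map_sum]
      refine IsUltrametricDist.norm_sum_le_of_forall_le_of_nonneg
        (mul_nonneg (Polynomial.supNorm_nonneg Q) zero_le_one) fun x _ ↦ ?_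
      rw [map_mul, norm_mul]
      exact mul_le_mul (hbdP Q x.1) (hbdO A x.2) (norm_nonneg _) (Polynomial.supNorm_nonneg Q)
    have h1 := hs.hasSum
    rwa [tsum_map_coeff_mul_mul_pow φ (hbdP Q) (hbdO A) hz, (hasSum_map_coeff_coe_mul_pow φ Q z).tsum_eq] at h1
  -- the right-hand side evaluates to `ω_n(z) q(z) = 0`
  have hR : HasSum (fun k ↦ φ (PowerSeries.coeff k
      ((((cyclotomicOmega p n).map (Int.castRingHom (PadicAlgCl p)) : (PadicAlgCl p)[X]) :
          PowerSeries (PadicAlgCl p)) * iwasawaOToPowerSeries S q)) * z ^ k) 0 := by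
    have h1 := hevalmul ((cyclotomicOmega p n).map (Int.castRingHom (PadicAlgCl p))) q
    have h0 : ((cyclotomicOmega p n).map (Int.castRingHom (PadicAlgCl p))).eval₂ φ z = 0 := by
      rw [eval₂_map, cyclotomicOmega, eval₂_sub, eval₂_pow, eval₂_add, eval₂_X, eval₂_one, add_comm z 1, hzn,
        sub_self]
    rwa [h0, zero_mul] at h1
  -- the left-hand side evaluates to `p^m (θ(z) − P(z) L(z))`
  have hθ : HasSum (fun k ↦ φ (PowerSeries.coeff k (θ : PowerSeries (PadicAlgCl p))) * z ^ k) (θ.eval₂ φ z) :=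
    hasSum_map_coeff_coe_mul_pow φ θ z
  have hL : HasSum (fun k ↦ φ (PowerSeries.coeff k
      (PowerSeries.C ((p : PadicAlgCl p) ^ m) * ((θ : PowerSeries (PadicAlgCl p)) -
        (P : PowerSeries (PadicAlgCl p)) * iwasawaOToPowerSeries S L))) * z ^ k)
      (φ ((p : PadicAlgCl p) ^ m) * (θ.eval₂ φ z -
        P.eval₂ φ z * ∑' k, φ (PowerSeries.coeff k (iwasawaOToPowerSeries S L)) * z ^ k)) := by
    have h1 := (hθ.sub (hevalmul P L)).mul_left (φ ((p : PadicAlgCl p) ^ m))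
    refine h1.congr_fun fun k ↦ ?_
    simp only [PowerSeries.coeff_C_mul, map_mul, map_sub]
    ring
  have key : ∑' k, φ (PowerSeries.coeff k
      (PowerSeries.C ((p : PadicAlgCl p) ^ m) * ((θ : PowerSeries (PadicAlgCl p)) -
        (P : PowerSeries (PadicAlgCl p)) * iwasawaOToPowerSeries S L))) * z ^ k =
      ∑' k, φ (PowerSeries.coeff k
        ((((cyclotomicOmega p n).map (Int.castRingHom (PadicAlgCl p)) : (PadicAlgCl p)[X]) :
          PowerSeries (PadicAlgCl p)) * iwasawaOToPowerSeries S q)) * z ^ k := by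
    rw [hmq]
  rw [hL.tsum_eq, hR.tsum_eq, mul_eq_zero] at key
  have hpm : φ ((p : PadicAlgCl p) ^ m) ≠ 0 := by
    rw [map_pow, map_natCast]
    exact pow_ne_zero _ (Nat.cast_ne_zero.mpr (Fact.out : p.Prime).ne_zero)
  exact sub_eq_zero.mp (key.resolve_left hpm)

variable {N : ℕ} (g : CuspForm (CongruenceSubgroup.Gamma0 N) 2) (ι : coeffField g →+* PadicAlgCl p) (Ω : ℂ)

/-- **The value of `θ_n(g; Ω)^ι` at a wild character is the twisted sum of the `K_g`-valued plus symbols**: for an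
even `ℂ_p`-valued Dirichlet character `χ` modulo `p^{n+e₀}` of `p`-power order,
`θ_n(g;Ω)^ι(χ(γ) − 1) = Σ_{a mod p^{n+e₀}} χ(a) · ι[a/p^{n+e₀}]⁺_{g,Ω}` (`(1+T)^s ↦ χ(γ)^s = χ(ηγ^s)` as `χ(η) = 1`;
`(η, s) ↦ ηγ^s` is a bijection onto the units; non-units contribute `0`).
[cite: Pollack2003, Prop. 6.9 (proof)] [cite: MazurTateTeitelbaum1986Invent, §I.13] -/
theorem eval₂_map_mazurTateElementK_eq_sum {n : ℕ}
    (χ : DirichletCharacter ℂ_[p] (p ^ (n + cyclotomicExponent p))) (heven : χ.Even)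
    (hord : ∃ j : ℕ, orderOf χ = p ^ j) :
    ((mazurTateElementK g Ω p n).map ι).eval₂ (algebraMap (PadicAlgCl p) ℂ_[p])
        (χ (cyclotomicGenerator p : ZMod (p ^ (n + cyclotomicExponent p))) - 1) =
      ∑ a : ZMod (p ^ (n + cyclotomicExponent p)),
        χ a * algebraMap (PadicAlgCl p) ℂ_[p]
          (ι (plusSymbolK g Ω ((a.val : ℚ) / (p : ℚ) ^ (n + cyclotomicExponent p)))) := by
  classical
  have hp : p.Prime := Fact.out
  haveI := neZero_torsionOrder p
  haveI := Fintype.ofFinite (rootsOfUnity (torsionOrder p) ℤ_[p])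
  haveI : NeZero (p ^ n) := ⟨pow_ne_zero _ hp.ne_zero⟩
  haveI : NeZero (p ^ (n + cyclotomicExponent p)) := ⟨pow_ne_zero _ hp.ne_zero⟩
  set G : ZMod (p ^ (n + cyclotomicExponent p)) → ℂ_[p] := fun b ↦
    χ b * algebraMap (PadicAlgCl p) ℂ_[p]
      (ι (plusSymbolK g Ω ((b.val : ℚ) / (p : ℚ) ^ (n + cyclotomicExponent p)))) with hG
  have h1 : ((mazurTateElementK g Ω p n).map ι).eval₂ (algebraMap (PadicAlgCl p) ℂ_[p])
      (χ (cyclotomicGenerator p : ZMod (p ^ (n + cyclotomicExponent p))) - 1) =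
      ∑ᶠ η : rootsOfUnity (torsionOrder p) ℤ_[p], ∑ s : ZMod (p ^ n),
        G (PadicInt.toZModPow (n + cyclotomicExponent p) ((η : ℤ_[p]ˣ) : ℤ_[p]) *
          (cyclotomicGenerator p : ZMod (p ^ (n + cyclotomicExponent p))) ^ s.val) := by
    rw [mazurTateElementK, finsum_eq_sum_of_fintype, finsum_eq_sum_of_fintype, Polynomial.map_sum, eval₂_finsetSum]
    refine Finset.sum_congr rfl fun η _ ↦ ?_
    rw [Polynomial.map_sum, eval₂_finsetSum]
    refine Finset.sum_congr rfl fun s _ ↦ ?_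
    rw [Polynomial.map_mul, Polynomial.map_pow, Polynomial.map_add, Polynomial.map_X, Polynomial.map_one,
      Polynomial.map_C, eval₂_mul, eval₂_C, eval₂_pow, eval₂_add, eval₂_X, eval₂_one, sub_add_cancel, hG]
    dsimp only
    rw [map_mul, map_pow, apply_toZModPow_rootsOfUnity χ heven hord η, one_mul, mul_comm]
  rw [h1, finsum_sum_classes_eq_sum_units p n G, sum_units_eq_sum_filter_isUnit, Finset.sum_filter]
  refine Finset.sum_congr rfl fun a _ ↦ ?_
  split_ifs with ha
  · rfl
  · rw [hG]
    dsimp only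
    rw [MulChar.map_nonunit χ ha, zero_mul]

end Eval

end Summit.BirchSwinnertonDyer.BirchSwinnertonDyer.Theorems.ResidualThetaLayer

end
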